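import Summits.HodgeConjecture.CorCM.Census.OcticWeilMultiParts
import HarnessLib

/-!
# ANY NUMBER `r` of CM types over one octic CM field: EXTRACTION of a generating part from a balanced configuration of
# `E × B₁ × ⋯ × B_r` and the INDUCTION PRINCIPLE

COR-CM (cell `pub-hodgecm2`), seat b30 gen 24 (2026-08-22); count-neutral own lane OCTIC-MULTI (census half), part 4; sequel of
`Census/OcticWeilMulti{,Defect,Parts}.lean`.  Theorems only of a finite model; no definition, no named fact, no geometry, no `sorry`,
no `decide`.  The four-pair twin of `Census/DecicWeil23MultiExtraction`, with slot weights `w_m ∈ {1, 2}` (`(1,3)`- resp.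
`(2,2)`-types).

RESULTS (kernel).  Elementary properties of sixfold and eightfold parts (the model map is NOT injective on a sixfold part: two
curve points — gen 18's re-slotting device is needed downstream); `exists_sixPartO_of_counts` (two curve points),
`exists_eightPartO_of_counts`; **EXTRACTION** `exists_part_of_modelBalancedO`; **INDUCTION PRINCIPLE** `modelBalancedO_induction`
over pair parts, four parts of `(2,2)`-slots, sixfold parts of `(1,3)`-slots and eightfold parts of two `(1,3)`-slots — the common
generalisation of gens 18 (`OcticCurveFourfold`), 20 (`OcticWeilMixed`) and 21 (`OcticWeil13Pair`) to arbitrary slots and positions.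
The four part needs NO curve point (Markman's fourfold theorem downstream), the sixfold part needs TWO (gen 18's device).
[cite: Pohlmann1968, Thm 1] [cite: GaoUllmo2025, Thm 3.1] [cite: Milne2020HodgeClassesAV, 1.2 (a) and Thm. 1]
[cite: MoonenZarhin1995Duke, Thm. 2.4]

## References
* [Pohlmann1968] Ann. of Math. 88 (1968), Thm 1.  [GaoUllmo2025] J. Inst. Math. Jussieu 25 (2025), Thm 3.1.
  [Milne2020HodgeClassesAV] arXiv:2010.08857, 1.2 (a), Thm. 1.  [MoonenZarhin1995Duke] Duke Math. J. 77 (1995), Thm. 2.4.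
-/

namespace Summit.HodgeConjecture.CorCM.Census.OcticWeilMulti

open Finset

variable {r : ℕ} {α : Type*} {P : Fin r → Fin 4 → Bool} {R : Finset (Equiv.Perm (Fin 4))} {v : α → PtO r}

/-! ### Elementary properties of the sixfold and eightfold parts -/

/-- Every point of a sixfold part lies over `inl b` or over a label `(m, a, b)`. [folklore] -/
theorem IsSixPartO.mem_cases {m : Fin r} {b : Bool} {G : Finset α} (hG : IsSixPartO v m b G) {x : α} (hx : x ∈ G) :
    v x = Sum.inl b ∨ ∃ a : Fin 4, v x = Sum.inr (m, (a, b)) := by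
  classical
  have hpos : 0 < (G.filter fun x' => v x' = v x).card := Finset.card_pos.2 ⟨x, Finset.mem_filter.2 ⟨hx, rfl⟩⟩
  rw [hG.count_eq] at hpos
  by_contra h
  push Not at h
  rw [if_neg h.1, if_neg (fun ⟨a, ha⟩ => h.2 a ha)] at hpos
  exact lt_irrefl 0 hpos

/-- A sixfold part is non-empty. [folklore] -/
theorem IsSixPartO.nonempty {m : Fin r} {b : Bool} {G : Finset α} (hG : IsSixPartO v m b G) : G.Nonempty := by
  rw [← Finset.card_pos, hG.1]; norm_num

/-- Every point of a eightfold part lies over a label `(m, a, true)` or `(m', a, false)`. [folklore] -/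
theorem IsEightPartO.mem_cases {m m' : Fin r} {G : Finset α} (hG : IsEightPartO v m m' G) {x : α} (hx : x ∈ G) :
    (∃ a : Fin 4, v x = Sum.inr (m, (a, true))) ∨ ∃ a : Fin 4, v x = Sum.inr (m', (a, false)) := by
  classical
  have hpos : 0 < (G.filter fun x' => v x' = v x).card := Finset.card_pos.2 ⟨x, Finset.mem_filter.2 ⟨hx, rfl⟩⟩
  rw [hG.count_eq] at hpos
  by_contra h
  rw [if_neg h] at hpos
  exact lt_irrefl 0 hpos

/-- The model map is injective on a eightfold part. [folklore] -/
theorem IsEightPartO.injOn {m m' : Fin r} {G : Finset α} (hG : IsEightPartO v m m' G) : Set.InjOn v ↑G := by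
  classical
  intro x hx x' hx' h
  have hle : (G.filter fun y => v y = v x).card ≤ 1 := by
    rw [hG.count_eq]; split_ifs <;> omega
  exact Finset.card_le_one.1 hle x (Finset.mem_filter.2 ⟨hx, rfl⟩) x' (Finset.mem_filter.2 ⟨hx', h.symm⟩)

/-- A eightfold part is non-empty. [folklore] -/
theorem IsEightPartO.nonempty {m m' : Fin r} {G : Finset α} (hG : IsEightPartO v m m' G) : G.Nonempty := by
  rw [← Finset.card_pos, hG.1]; norm_num


/-! ### Sixfold and eightfold parts from the counts -/

/-- A sixfold part inside `T` from the counts: TWO points over `inl b` and one over each `(m, a, b)`. [folklore] -/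
theorem exists_sixPartO_of_counts [DecidableEq α] {T : Finset α} (m : Fin r) (b : Bool)
    (hE : 1 < (T.filter fun x => v x = Sum.inl b).card)
    (hB : ∀ a : Fin 4, 0 < (T.filter fun x => v x = Sum.inr (m, (a, b))).card) : ∃ G ⊆ T, IsSixPartO v m b G := by
  obtain ⟨x₁, hx₁, x₂, hx₂, hne⟩ := Finset.one_lt_card.1 hE
  obtain ⟨hx₁T, hvx₁⟩ := Finset.mem_filter.1 hx₁
  obtain ⟨hx₂T, hvx₂⟩ := Finset.mem_filter.1 hx₂
  obtain ⟨W, hWT, hW⟩ := exists_fourPartO_of_counts (v := v) (T := T) m b hB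
  have hxW : ∀ x, v x = Sum.inl b → x ∉ W := fun x hvx h => by
    obtain ⟨a, ha⟩ := hW.exists_eq_inr h
    rw [hvx] at ha; exact Sum.inl_ne_inr ha
  have hx₂W := hxW x₂ hvx₂
  have hx₁₂ : x₁ ∉ insert x₂ W := by
    rw [Finset.mem_insert]
    rintro (h | h)
    exacts [hne h, hxW x₁ hvx₁ h]
  refine ⟨insert x₁ (insert x₂ W), Finset.insert_subset hx₁T (Finset.insert_subset hx₂T hWT), ?_, ?_, fun a => ?_⟩
  · rw [Finset.card_insert_of_notMem hx₁₂, Finset.card_insert_of_notMem hx₂W, hW.1]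
  · rw [Finset.filter_insert, if_pos hvx₁, Finset.filter_insert, if_pos hvx₂, Finset.filter_false_of_mem fun z hz => ?_,
      Finset.card_insert_of_notMem (by simp [hne]), Finset.card_insert_of_notMem (by simp), Finset.card_empty]
    obtain ⟨a, ha⟩ := hW.exists_eq_inr hz
    rw [ha]; exact Sum.inr_ne_inl
  · rw [Finset.filter_insert, if_neg (by rw [hvx₁]; exact Sum.inl_ne_inr), Finset.filter_insert,
      if_neg (by rw [hvx₂]; exact Sum.inl_ne_inr), hW.2 a]

/-- An eightfold part inside `T` from the counts: one point over each `(m, a, true)` and each `(m', a, false)`. [folklore] -/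
theorem exists_eightPartO_of_counts [DecidableEq α] {T : Finset α} (m m' : Fin r)
    (h0 : ∀ a : Fin 4, 0 < (T.filter fun x => v x = Sum.inr (m, (a, true))).card)
    (h1 : ∀ a : Fin 4, 0 < (T.filter fun x => v x = Sum.inr (m', (a, false))).card) : ∃ G ⊆ T, IsEightPartO v m m' G := by
  obtain ⟨W₀, hW₀T, hW₀⟩ := exists_fourPartO_of_counts (v := v) (T := T) m true h0
  obtain ⟨W₁, hW₁T, hW₁⟩ := exists_fourPartO_of_counts (v := v) (T := T) m' false h1
  have hW : Disjoint W₀ W₁ := by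
    rw [Finset.disjoint_left]
    intro x hx0 hx1
    obtain ⟨a, ha⟩ := hW₀.exists_eq_inr hx0
    obtain ⟨a', ha'⟩ := hW₁.exists_eq_inr hx1
    have := ha.symm.trans ha'
    simp at this
  refine ⟨W₀ ∪ W₁, Finset.union_subset hW₀T hW₁T, ?_, fun a => ?_, fun a => ?_⟩
  · rw [Finset.card_union_of_disjoint hW, hW₀.1, hW₁.1]
  · rw [Finset.filter_union, Finset.filter_false_of_mem (s := W₁) fun x hx => ?_, Finset.union_empty, hW₀.2 a]
    obtain ⟨a', ha'⟩ := hW₁.exists_eq_inr hx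
    rw [ha']; simp
  · rw [Finset.filter_union, Finset.filter_false_of_mem (s := W₀) fun x hx => ?_, Finset.empty_union, hW₁.2 a]
    obtain ⟨a', ha'⟩ := hW₀.exists_eq_inr hx
    rw [ha']; simp

/-! ### Extraction and induction -/

section Extraction

variable (w : Fin r → ℕ) (hP : ∀ m, ((univ : Finset (Fin 4)).filter fun a => P m a = true).card = w m)
  (hw : ∀ m, w m = 1 ∨ w m = 2) (hind : IndepPosO P)
  (hmul : ∀ π₁ ∈ R, ∀ π₂ ∈ R, π₁ * π₂ ∈ R) (h2 : ∀ a b x y : Fin 4, a ≠ b → x ≠ y → ∃ π ∈ R, π a = x ∧ π b = y)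

include hP hw hind hmul h2 in
/-- **EXTRACTION (octic).**  Under weights `w_m ∈ {1, 2}`, `IndepPosO P` and `R` closed under composition and `2`-transitive, a
non-empty `R`-balanced configuration contains a pair part, a four part of a `(2,2)`-slot, a sixfold part of a `(1,3)`-slot, or an
eightfold part of two `(1,3)`-slots: by the defect law `d_{m,a} = t_m`, `e = Σ_{w_m = 1} 2t_m`, a `(2,2)`-slot with `t_m ≠ 0` gives a
four part; otherwise two `(1,3)`-slots of strictly opposite defects give an eightfold part; otherwise a `(1,3)`-slot with `t_m ≠ 0`
has `|e| ≥ 2` of the same sign — a sixfold part; if all defects vanish, `e = 0` and a pair part exists.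
[cite: Milne2020HodgeClassesAV, 1.2 (a) and Thm. 1] [cite: MoonenZarhin1995Duke, Thm. 2.4] -/
theorem exists_part_of_modelBalancedO [DecidableEq α] {T : Finset α} (hT : ModelBalancedO P R v T) (hne : T.Nonempty) :
    ∃ G ⊆ T, IsPairPartO v G ∨ (∃ m b, w m = 2 ∧ IsFourPartO v m b G) ∨ (∃ m b, w m = 1 ∧ IsSixPartO v m b G) ∨
      ∃ m m', w m = 1 ∧ w m' = 1 ∧ IsEightPartO v m m' G := by
  obtain ⟨t, ht, hE⟩ := exists_defectO_of_modelBalancedO w hP hind hmul h2 hT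
  -- a `(2,2)`-slot with non-zero defect: a four part
  by_cases h4 : ∃ m, w m = 2 ∧ t m ≠ 0
  · obtain ⟨m, hm2, hm⟩ := h4
    rcases lt_or_gt_of_ne hm with hlt | hgt
    · obtain ⟨G, hG, h⟩ := exists_fourPartO_of_counts (v := v) (T := T) m false fun a => by have h := ht m a; omega
      exact ⟨G, hG, Or.inr (Or.inl ⟨m, false, hm2, h⟩)⟩
    · obtain ⟨G, hG, h⟩ := exists_fourPartO_of_counts (v := v) (T := T) m true fun a => by have h := ht m a; omega
      exact ⟨G, hG, Or.inr (Or.inl ⟨m, true, hm2, h⟩)⟩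
  have h4' : ∀ m, w m = 2 → t m = 0 := fun m hm => by
    by_contra h
    exact h4 ⟨m, hm, h⟩
  -- the curve defect is twice the sum of the `(1,3)`-defects
  have hE' : ((T.filter fun x => v x = Sum.inl true).card : ℤ) - (T.filter fun x => v x = Sum.inl false).card =
      ∑ m : Fin r, (if w m = 1 then 2 * t m else 0) := by
    rw [hE]
    refine Finset.sum_congr rfl fun m _ => ?_
    rcases hw m with h | h
    · rw [if_pos h, h]; push_cast; ring
    · rw [if_neg (by omega), h4' m h, mul_zero]
  -- two `(1,3)`-slots of strictly opposite defects: an eightfold part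
  by_cases h8 : ∃ m m', w m = 1 ∧ w m' = 1 ∧ 0 < t m ∧ t m' < 0
  · obtain ⟨m, m', hm1, hm'1, hm, hm'⟩ := h8
    obtain ⟨G, hG, h⟩ := exists_eightPartO_of_counts (v := v) (T := T) m m'
      (fun a => by have h := ht m a; omega) (fun a => by have h := ht m' a; omega)
    exact ⟨G, hG, Or.inr (Or.inr (Or.inr ⟨m, m', hm1, hm'1, h⟩))⟩
  -- a sixfold part of positive sign
  by_cases hpos : ∃ m, w m = 1 ∧ 0 < t m
  · obtain ⟨m, hm1, hm⟩ := hpos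
    have hnn : ∀ m', 0 ≤ (if w m' = 1 then 2 * t m' else 0) := fun m' => by
      split_ifs with h
      · have : ¬ t m' < 0 := fun hlt => h8 ⟨m, m', hm1, h, hm, hlt⟩
        omega
      · exact le_rfl
    have hle : 2 * t m ≤ ∑ m' : Fin r, (if w m' = 1 then 2 * t m' else 0) := by
      have h := Finset.single_le_sum (f := fun m' => if w m' = 1 then 2 * t m' else 0) (fun m' _ => hnn m') (Finset.mem_univ m)
      rwa [if_pos hm1] at h
    obtain ⟨G, hG, hS⟩ := exists_sixPartO_of_counts (v := v) (T := T) m true (by omega) fun a => by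
      have h := ht m a; omega
    exact ⟨G, hG, Or.inr (Or.inr (Or.inl ⟨m, true, hm1, hS⟩))⟩
  -- a sixfold part of negative sign
  by_cases hneg : ∃ m, w m = 1 ∧ t m < 0
  · obtain ⟨m, hm1, hm⟩ := hneg
    have hnp : ∀ m', (if w m' = 1 then 2 * t m' else 0) ≤ 0 := fun m' => by
      split_ifs with h
      · have : ¬ 0 < t m' := fun hlt => hpos ⟨m', h, hlt⟩
        omega
      · exact le_rfl
    have hle : ∑ m' : Fin r, (if w m' = 1 then 2 * t m' else 0) ≤ 2 * t m := by
      have h := Finset.single_le_sum (f := fun m' => -(if w m' = 1 then 2 * t m' else 0))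
        (fun m' _ => by have h' := hnp m'; omega) (Finset.mem_univ m)
      rw [if_pos hm1, Finset.sum_neg_distrib] at h
      omega
    obtain ⟨G, hG, hS⟩ := exists_sixPartO_of_counts (v := v) (T := T) m false (by omega) fun a => by
      have h := ht m a; omega
    exact ⟨G, hG, Or.inr (Or.inr (Or.inl ⟨m, false, hm1, hS⟩))⟩
  -- all defects vanish: a pair part
  have htm : ∀ m : Fin r, t m = 0 := fun m => by
    rcases hw m with h | h
    · have h1 : ¬ 0 < t m := fun h' => hpos ⟨m, h, h'⟩
      have h2 : ¬ t m < 0 := fun h' => hneg ⟨m, h, h'⟩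
      omega
    · exact h4' m h
  have hz : ∀ (m : Fin r) (a : Fin 4), (T.filter fun x => v x = Sum.inr (m, (a, true))).card =
      (T.filter fun x => v x = Sum.inr (m, (a, false))).card := by
    intro m a
    have h := ht m a
    rw [htm m] at h
    omega
  have hsum : ∑ m : Fin r, (if w m = 1 then 2 * t m else 0) = 0 :=
    Finset.sum_eq_zero fun m _ => by rw [htm m, mul_zero, ite_self]
  have hEE : (T.filter fun x => v x = Sum.inl true).card = (T.filter fun x => v x = Sum.inl false).card := by
    rw [hsum] at hE'; omega
  obtain ⟨x, hx⟩ := hne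
  have hNx : 0 < (T.filter fun x' => v x' = v x).card := Finset.card_pos.2 ⟨x, Finset.mem_filter.2 ⟨hx, rfl⟩⟩
  have hNcx : 0 < (T.filter fun x' => v x' = cjO (v x)).card := by
    rcases hvx : v x with s | ⟨m, ⟨a, s⟩⟩ <;> rw [hvx] at hNx
    · cases s
      · rw [cjO_inl, Bool.not_false]; omega
      · rw [cjO_inl, Bool.not_true]; omega
    · have h := hz m a
      cases s
      · rw [cjO_inr, Bool.not_false]; omega
      · rw [cjO_inr, Bool.not_true]; omega
  obtain ⟨G, hG, hP'⟩ := exists_pairPartO_of_counts (y := v x) hNx hNcx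
  exact ⟨G, hG, Or.inl hP'⟩

include hP hw hind hmul h2 in
/-- **INDUCTION PRINCIPLE FOR BALANCED CONFIGURATIONS (octic, any number of copies of `E, B₁, …, B_r`).**  If `motive` holds for `∅`
and passes from `S` to `G ∪ S` for `G` disjoint from `S` a pair part, a four part of a `(2,2)`-slot, a sixfold part of a `(1,3)`-slot
or an eightfold part of two `(1,3)`-slots, then `motive` holds for every `R`-balanced configuration.
[cite: Milne2020HodgeClassesAV, 1.2 (a) and Thm. 1] [cite: GaoUllmo2025, Thm 3.1] -/
theorem modelBalancedO_induction [DecidableEq α] {motive : Finset α → Prop} (h0 : motive ∅)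
    (hpair : ∀ G S : Finset α, Disjoint G S → IsPairPartO v G → motive S → motive (G ∪ S))
    (hfour : ∀ (G S : Finset α) (m : Fin r) (b : Bool), w m = 2 → Disjoint G S → IsFourPartO v m b G → motive S → motive (G ∪ S))
    (hsix : ∀ (G S : Finset α) (m : Fin r) (b : Bool), w m = 1 → Disjoint G S → IsSixPartO v m b G → motive S → motive (G ∪ S))
    (height : ∀ (G S : Finset α) (m m' : Fin r), w m = 1 → w m' = 1 → Disjoint G S → IsEightPartO v m m' G → motive S →
      motive (G ∪ S))
    {T : Finset α} (hT : ModelBalancedO P R v T) : motive T := by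
  induction T using Finset.strongInduction with
  | H T ih =>
    by_cases hTe : T = ∅
    · subst hTe; exact h0
    obtain ⟨G, hGT, hG⟩ := exists_part_of_modelBalancedO w hP hw hind hmul h2 hT (Finset.nonempty_iff_ne_empty.2 hTe)
    rcases hG with hPG | ⟨m, b, hm, hS⟩ | ⟨m, b, hm, hS⟩ | ⟨m, m', hm, hm', h10⟩
    · have hR : ModelBalancedO P R v (T \ G) := hT.sdiff (fun π _ => hPG.balancedO P w hP π) hGT
      have hlt : T \ G ⊂ T := Finset.sdiff_ssubset hGT hPG.nonempty
      have h := hpair G (T \ G) Finset.disjoint_sdiff hPG (ih _ hlt hR)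
      rwa [Finset.union_sdiff_of_subset hGT] at h
    · have hR : ModelBalancedO P R v (T \ G) := hT.sdiff (fun π _ => hS.balancedO P w hP hm π) hGT
      have hlt : T \ G ⊂ T := Finset.sdiff_ssubset hGT hS.nonempty
      have h := hfour G (T \ G) m b hm Finset.disjoint_sdiff hS (ih _ hlt hR)
      rwa [Finset.union_sdiff_of_subset hGT] at h
    · have hR : ModelBalancedO P R v (T \ G) := hT.sdiff (fun π _ => hS.balancedO P w hP hm π) hGT
      have hlt : T \ G ⊂ T := Finset.sdiff_ssubset hGT hS.nonempty
      have h := hsix G (T \ G) m b hm Finset.disjoint_sdiff hS (ih _ hlt hR)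
      rwa [Finset.union_sdiff_of_subset hGT] at h
    · have hR : ModelBalancedO P R v (T \ G) := hT.sdiff (fun π _ => h10.balancedO P w hP (hm.trans hm'.symm) π) hGT
      have hlt : T \ G ⊂ T := Finset.sdiff_ssubset hGT h10.nonempty
      have h := height G (T \ G) m m' hm hm' Finset.disjoint_sdiff h10 (ih _ hlt hR)
      rwa [Finset.union_sdiff_of_subset hGT] at h

end Extraction

end Summit.HodgeConjecture.CorCM.Census.OcticWeilMulti
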